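import Summits.AtomisticToContinuum.FouriersLaw.Theorems.BondHeatUncertaintySubdiffusiveBondHeatOfDeficitCesaroEW

/-!
# `SubdiffusiveBondHeat`, line `bath-bond-deficit-integral`: the free `N`-uniform LINEAR ceiling of the stub's functional

Crux `stmt-AtomisticToContinuum-9120` (`BondHeatUncertainty.SubdiffusiveBondHeat`, (S)).  The line's one open stub
`stub_deficitCesaroEW` asks for the Edwards–Wilkinson bound `W_N(t) := ∫₀ᵗ (1 − θ_N(s)) ds ≤ C √t` on the Thouless window
`[1, cN²]`, `N ≥ N₀`, where `θ_N(s) = (γ/T²)∫₀ˢ K_N`, `K_N(u) = ∫ (p₀² − T) · P_u(p₀² − T) dμ_T^N` (VERBATIM the `let θ / K`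
of route `BoundaryEscapeDeficit`).  This file records what is FREE, uniformly in `N` and for ALL times (no light cone, no
window), from the landed fixed-`N` kernel calculus:

* `pinnedChain_primitive_kinKernel_integral_eq` — the triangle identity `∫₀ᵗ ∫₀ˢ K_N du ds = ∫₀ᵗ (t − r) K_N(r) dr`
  (`pinnedChain_integral_integral_kernelPairing_triangle` at `f = h = p₀² − T`, Gibbs invariance);
* `pinnedChain_primitive_kinKernel_integral_nonneg` — `0 ≤ ∫₀ᵗ ∫₀ˢ K_N du ds`, because
  `2∫₀ᵗ (t − r) K_N(r) dr = E_{μ_T⊗W}[(∫₀ᵗ (p₀² − T)(z_s) ds)²] ≥ 0` (`pinnedChain_timeIntegral_sq`);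
* `pinnedChain_deficitCesaro_le_self` — hence the BALLISTIC CEILING `W_N(t) ≤ t` for every `t ≥ 0` and every `N ≥ 1`
  (the deficit curve `1 − θ_N` is `≤ 1` in Cesàro mean; equivalently `Var_eq(Q^L_t) ≤ 2γT² t`: the reservoir-heat
  variance never exceeds the variance of the injected noise work), and `deficitCesaro_le_self` — the same in the stub's
  `dite` spelling, for every `N : ℕ`;
* `pinnedChain_bathBondHeatVar_le_linear_allTimes` — with the landed bath-bond reduction
  (`stub_bathBondReduction_of_kernelFacts` fed with the landed kernel detailed balance, Dynkin identity and static
  covariance bound) and the landed uniform statics `E_{μ_T}[e₀²] ≤ σ²` (`localEnergyMoment`):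
  `V_N(0,t) ≤ 4γT² t + 8σ²` for every `N ≥ 2` and every `t ≥ 0`;
* `bathBondHeatVar_le_linear` — in the crux's spelling (`C`, `V` verbatim the `let`s of `SubdiffusiveBondHeat`):
  `∃ B, ∀ N ≥ 2, ∀ t ≥ 1, V N 0 t ≤ B·t` — the `N`-UNIFORM LINEAR CEILING OF THE CRUX FUNCTIONAL AT THE BATH BOND AT ALL
  TIMES.  The sibling `LightConeBondHeat.lightCone_bondHeatVar_le_linear` (tent reduction + statics) gives `B·t` only inside
  the light cone `t ≤ N/2`; here the restriction disappears because the reservoir, not a tent, closes the energy balance.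

Reading for the crux: (S) asks `A√t` up to `cN²`; everything between `t` and `√t` is the open `N`-uniform dynamical content
(`Cruxes/SubdiffusiveBondHeat/STRATEGY-CENSUS.md`).  At the harmonic member `lam = β = 0` the linear law is SATURATED
(`W_N(t) ∼ E_N t`, `E_N = 1/8`; `V_N(0,t)/t → 0.30`, Disproof.lean §5–§6), so no phonon-blind argument improves the exponent.
Nothing here closes the item.
-/

noncomputable section

open MeasureTheory Set Filter Topology intervalIntegral
open scoped NNReal

namespace Summit.AtomisticToContinuum.FouriersLaw.Theorems.SubdiffusiveBondHeat

open Literature.MathematicalPhysics.KineticTheory.HeatConduction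
open Literature.Probability.Process

section FixedN

variable {ω₂ lam β γ T : ℝ} (hω : 0 < ω₂) (hl : 0 < lam) (hβ : 0 < β) (hγ : 0 < γ) (hT : 0 < T) {N : ℕ}
  (hN : 0 < N)
include hω hl hβ hγ hT hN

omit hγ in
/-- `(p₀² − T)² ∈ L¹(μ_T)` (Gaussian momentum marginal; from the landed `pinnedChain_integrable_sq_kineticDeviation`).
[folklore] -/
theorem pinnedChain_integrable_sq_kinObs₀ :
    Integrable (fun y : PhaseSpace N => ((y.2 ⟨0, hN⟩) ^ 2 - T) ^ 2) ((pinnedChain ω₂ lam β γ).gibbsMeasure N T) := by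
  have h := pinnedChain_integrable_sq_kineticDeviation hω hl.le hβ.le γ N hT 1 T ⟨0, hN⟩
  refine h.congr (Eventually.of_forall fun y => ?_)
  simp only
  ring

/-- **Triangle identity for the boundary kernel**: `∫₀ᵗ (∫₀ˢ K_N(u) du) ds = ∫₀ᵗ (t − r) K_N(r) dr` for `t ≥ 0`
(`pinnedChain_integral_integral_kernelPairing_triangle` at `f = h = p₀² − T` under the invariant Gibbs measure). [folklore] -/
theorem pinnedChain_primitive_kinKernel_integral_eq {t : ℝ} (ht : 0 ≤ t) :
    ∫ s in (0 : ℝ)..t, (∫ u in (0 : ℝ)..s,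
        ∫ z, ((z.2 ⟨0, hN⟩) ^ 2 - T) *
            (∫ y, ((y.2 ⟨0, hN⟩) ^ 2 - T) ∂((pinnedChain ω₂ lam β γ).transitionKernel N T T u.toNNReal z))
          ∂((pinnedChain ω₂ lam β γ).gibbsMeasure N T)) =
      ∫ r in (0 : ℝ)..t, (t - r) *
        ∫ z, ((z.2 ⟨0, hN⟩) ^ 2 - T) *
            (∫ y, ((y.2 ⟨0, hN⟩) ^ 2 - T) ∂((pinnedChain ω₂ lam β γ).transitionKernel N T T r.toNNReal z))
          ∂((pinnedChain ω₂ lam β γ).gibbsMeasure N T) := by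
  have hinv : ∀ s : ℝ≥0, ((pinnedChain ω₂ lam β γ).gibbsMeasure N T).bind
      ((pinnedChain ω₂ lam β γ).transitionKernel N T T s) = (pinnedChain ω₂ lam β γ).gibbsMeasure N T := fun s =>
    pinnedChain_gibbsMeasure_bind_transitionKernel hω hl.le hβ.le hγ.le hN hT s
  haveI : IsProbabilityMeasure ((pinnedChain ω₂ lam β γ).gibbsMeasure N T) :=
    pinnedChain_isProbabilityMeasure_gibbsMeasure hω hl.le hβ.le γ N hT
  have hKm : Measurable (fun y : PhaseSpace N => (y.2 ⟨0, hN⟩) ^ 2 - T) := by fun_prop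
  have hK2 := pinnedChain_integrable_sq_kinObs₀ (γ := γ) hω hl hβ hT hN
  exact pinnedChain_integral_integral_kernelPairing_triangle hω hl.le hβ.le hγ.le N T T
    ((pinnedChain ω₂ lam β γ).gibbsMeasure N T) hinv hKm hKm hK2 hK2 ht

/-- **The iterated primitive of the boundary kernel is nonnegative**: `0 ≤ ∫₀ᵗ ∫₀ˢ K_N du ds` for `t ≥ 0`, since by the
triangle identity and `pinnedChain_timeIntegral_sq` it is half the second moment `E_{μ_T⊗W}[(∫₀ᵗ (p₀² − T)(z_s) ds)²]`
of a time integral along the stationary constructed flow. [folklore] -/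
theorem pinnedChain_primitive_kinKernel_integral_nonneg {t : ℝ} (ht : 0 ≤ t) :
    0 ≤ ∫ s in (0 : ℝ)..t, (∫ u in (0 : ℝ)..s,
        ∫ z, ((z.2 ⟨0, hN⟩) ^ 2 - T) *
            (∫ y, ((y.2 ⟨0, hN⟩) ^ 2 - T) ∂((pinnedChain ω₂ lam β γ).transitionKernel N T T u.toNNReal z))
          ∂((pinnedChain ω₂ lam β γ).gibbsMeasure N T)) := by
  have hinv : ∀ s : ℝ≥0, ((pinnedChain ω₂ lam β γ).gibbsMeasure N T).bind
      ((pinnedChain ω₂ lam β γ).transitionKernel N T T s) = (pinnedChain ω₂ lam β γ).gibbsMeasure N T := fun s =>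
    pinnedChain_gibbsMeasure_bind_transitionKernel hω hl.le hβ.le hγ.le hN hT s
  haveI : IsProbabilityMeasure ((pinnedChain ω₂ lam β γ).gibbsMeasure N T) :=
    pinnedChain_isProbabilityMeasure_gibbsMeasure hω hl.le hβ.le γ N hT
  have hKm : Measurable (fun y : PhaseSpace N => (y.2 ⟨0, hN⟩) ^ 2 - T) := by fun_prop
  have hK2 := pinnedChain_integrable_sq_kinObs₀ (γ := γ) hω hl hβ hT hN
  have hsq := pinnedChain_timeIntegral_sq ω₂ lam β γ hω hl.le hβ.le hγ.le N T T
    ((pinnedChain ω₂ lam β γ).gibbsMeasure N T) hinv (fun y : PhaseSpace N => (y.2 ⟨0, hN⟩) ^ 2 - T) hKm hK2 t ht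
  have h0 : 0 ≤ ∫ p, (∫ s in (0 : ℝ)..t, (fun y : PhaseSpace N => (y.2 ⟨0, hN⟩) ^ 2 - T)
      ((pinnedChain ω₂ lam β γ).solMap N T T s p.1 (pairPath p.2))) ^ 2
        ∂(((pinnedChain ω₂ lam β γ).gibbsMeasure N T).prod wienerPair) :=
    integral_nonneg fun _ => sq_nonneg _
  rw [hsq] at h0
  rw [pinnedChain_primitive_kinKernel_integral_eq hω hl hβ hγ hT hN ht]
  linarith

/-- **Ballistic ceiling of the Cesàro deficit, `N`-uniform, all times**: `W_N(t) = ∫₀ᵗ (1 − θ_N(s)) ds ≤ t` for every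
`t ≥ 0` and every `N ≥ 1` — the deficit curve is `≤ 1` in Cesàro mean (equivalently `Var_eq(Q^L_t) ≤ 2γT²t`).
Proof: `W_N(t) = t − (γ/T²)∫₀ᵗ∫₀ˢ K_N` and the iterated primitive is `≥ 0`. [folklore] -/
theorem pinnedChain_deficitCesaro_le_self {t : ℝ} (ht : 0 ≤ t) :
    ∫ s in (0 : ℝ)..t, (1 - γ / T ^ 2 * ∫ u in (0 : ℝ)..s,
        ∫ z, ((z.2 ⟨0, hN⟩) ^ 2 - T) *
            (∫ y, ((y.2 ⟨0, hN⟩) ^ 2 - T) ∂((pinnedChain ω₂ lam β γ).transitionKernel N T T u.toNNReal z))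
          ∂((pinnedChain ω₂ lam β γ).gibbsMeasure N T)) ≤ t := by
  set F : ℝ → ℝ := fun s => ∫ u in (0 : ℝ)..s,
      ∫ z, ((z.2 ⟨0, hN⟩) ^ 2 - T) *
          (∫ y, ((y.2 ⟨0, hN⟩) ^ 2 - T) ∂((pinnedChain ω₂ lam β γ).transitionKernel N T T u.toNNReal z))
        ∂((pinnedChain ω₂ lam β γ).gibbsMeasure N T) with hF
  -- `F` is continuous (primitive of the continuous kernel), hence interval integrable
  have hθc := pinnedChain_continuous_stepResponse hω hl hβ hγ hT hN
  obtain ⟨-, hKc, -, -, -⟩ := boundaryKernelBasics_proof ω₂ lam β γ hω hl hβ hγ T hT N hN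
  simp only [dif_pos hN] at hKc
  have hFc : Continuous F := intervalIntegral.continuous_primitive (fun a b => hKc.intervalIntegrable a b) 0
  have hFi : IntervalIntegrable F volume 0 t := hFc.intervalIntegrable 0 t
  have hFi' : IntervalIntegrable (fun s => γ / T ^ 2 * F s) volume 0 t := hFi.const_mul _
  have hsplit : ∫ s in (0 : ℝ)..t, (1 - γ / T ^ 2 * F s) = t - γ / T ^ 2 * ∫ s in (0 : ℝ)..t, F s := by
    rw [intervalIntegral.integral_sub intervalIntegrable_const hFi', intervalIntegral.integral_const,
      intervalIntegral.integral_const_mul, sub_zero, smul_eq_mul, mul_one]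
  have hpos : 0 ≤ ∫ s in (0 : ℝ)..t, F s := pinnedChain_primitive_kinKernel_integral_nonneg hω hl hβ hγ hT hN ht
  have hγT : 0 ≤ γ / T ^ 2 := div_nonneg hγ.le (by positivity)
  have : ∫ s in (0 : ℝ)..t, (1 - γ / T ^ 2 * F s) ≤ t := by
    rw [hsplit]
    nlinarith [mul_nonneg hγT hpos]
  simpa only [hF] using this

end FixedN

/-- **Ballistic ceiling of the Cesàro deficit in the stub's spelling** (`dite` on `0 < N`, every `N : ℕ`): for all
parameters `> 0`, `T > 0`, every `N` and every `t ≥ 0`, `∫₀ᵗ (1 − (γ/T²)∫₀ˢ K_N) ds ≤ t` (for `N = 0` the kernel is the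
junk `0` and the bound is an equality). This is the free `N`-uniform companion of the registered open stub
`stub_deficitCesaroEW` (which asks `≤ C√t` on `[1, cN²]`). [folklore] -/
theorem deficitCesaro_le_self :
    ∀ ω₂ lam β γ : ℝ, 0 < ω₂ → 0 < lam → 0 < β → 0 < γ → ∀ T : ℝ, 0 < T → ∀ (N : ℕ) (t : ℝ), 0 ≤ t →
      (∫ s in (0 : ℝ)..t,
        (1 - γ / T ^ 2 * (∫ u in (0 : ℝ)..s,
          if h : 0 < N then
            ∫ z, ((z.2 ⟨0, h⟩) ^ 2 - T) *
                (∫ y, ((y.2 ⟨0, h⟩) ^ 2 - T)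
                  ∂((pinnedChain ω₂ lam β γ).transitionKernel N T T u.toNNReal z))
              ∂((pinnedChain ω₂ lam β γ).gibbsMeasure N T)
          else 0))) ≤ t := by
  intro ω₂ lam β γ hω hl hβ hγ T hT N t ht
  rcases Nat.eq_zero_or_pos N with h0 | hN
  · subst h0
    simp only [lt_self_iff_false, dif_neg, not_false_eq_true, intervalIntegral.integral_zero, mul_zero, sub_zero,
      intervalIntegral.integral_const, smul_eq_mul, mul_one, le_refl]
  · simp only [dif_pos hN]
    exact pinnedChain_deficitCesaro_le_self hω hl hβ hγ hT hN ht

/-- **`N`-uniform linear ceiling of the bath-bond heat variance at ALL times**: for all parameters `> 0` and `T > 0`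
there is `σ²` (the landed uniform static bound `E_{μ_T}[e₀²] ≤ σ²`, `localEnergyMoment`) such that for every `N ≥ 2` and
every `t ≥ 0`, `V_N(0,t) = 2∫₀ᵗ (t−s) C_N(0,s) ds ≤ 4γT²·t + 8σ²`.  Proof: the landed bath-bond reduction
`V_N(0,t) ≤ 4γT² W_N(t) + 8E[e₀²]` (`stub_bathBondReduction_of_kernelFacts` with the landed kernel detailed balance,
Dynkin identity and static covariance bound) and `W_N(t) ≤ t` (`pinnedChain_deficitCesaro_le_self`). [folklore] -/
theorem pinnedChain_bathBondHeatVar_le_linear_allTimes {ω₂ lam β γ : ℝ} (hω : 0 < ω₂) (hl : 0 < lam) (hβ : 0 < β)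
    (hγ : 0 < γ) {T : ℝ} (hT : 0 < T) :
    ∃ σ2 : ℝ, ∀ (N : ℕ) (hN : 1 < N) (t : ℝ), 0 ≤ t →
      2 * (∫ s in (0 : ℝ)..t, (t - s) *
          ∫ z, (pinnedChain ω₂ lam β γ).bondCurrent N ⟨0, Nat.zero_lt_of_lt hN⟩ z *
              (∫ y, (pinnedChain ω₂ lam β γ).bondCurrent N ⟨0, Nat.zero_lt_of_lt hN⟩ y
                ∂((pinnedChain ω₂ lam β γ).transitionKernel N T T s.toNNReal z))
            ∂((pinnedChain ω₂ lam β γ).gibbsMeasure N T)) ≤ 4 * γ * T ^ 2 * t + 8 * σ2 := by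
  obtain ⟨σ2, hσ⟩ := localEnergyMoment ω₂ lam β γ hω hl hβ hγ T hT
  refine ⟨σ2, fun N hN t ht => ?_⟩
  have hN0 : 0 < N := Nat.zero_lt_of_lt hN
  have hred := stub_bathBondReduction_of_kernelFacts ω₂ lam β γ hω hl hβ hγ T hT N hN
    (stub_kernelDetailedBalance ω₂ lam β γ hω hl hβ hγ T hT N hN)
    (stub_siteEnergyDynkin ω₂ lam β γ hω hl hβ hγ T hT N hN)
    (stub_siteEnergyCurrentCovariance ω₂ lam β γ hω hl hβ hγ T hT N hN) t ht
  have hW := pinnedChain_deficitCesaro_le_self hω hl hβ hγ hT hN0 ht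
  have hmom := hσ N hN
  have hγT : 0 ≤ 4 * γ * T ^ 2 := by positivity
  calc _ ≤ _ := hred
    _ ≤ 4 * γ * T ^ 2 * t + 8 * σ2 := by nlinarith [mul_le_mul_of_nonneg_left hW hγT]

/-- **The `N`-uniform linear ceiling of the crux functional at the bath bond, all times, in the item's spelling.**  For
the pinned anharmonic chain (all parameters `> 0`) and `T > 0`: `∃ B ∀ N ≥ 2 ∀ t ≥ 1, V_N(0,t) ≤ B·t` (`C`, `V` verbatim
the `let`s of `SubdiffusiveBondHeat` / `LightConeBondHeat`; `B = 4γT² + 8 max(σ²,0)`).  Compare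
`LightConeBondHeat.lightCone_bondHeatVar_le_linear` (`t ≤ N/2` only): the bath closes the energy balance at every time,
so no light-cone restriction is needed.  The crux asks `A√t` on `[1, cN²]`; the gap `t ↦ √t` is its open content. [folklore] -/
theorem bathBondHeatVar_le_linear :
    ∀ ω₂ lam β γ : ℝ, 0 < ω₂ → 0 < lam → 0 < β → 0 < γ → ∀ T : ℝ, 0 < T →
      (let P := pinnedChain ω₂ lam β γ;
       let C : ℕ → ℕ → ℝ → ℝ := fun N b s => if h : b < N then ∫ z, P.bondCurrent N ⟨b, h⟩ z *
         (∫ y, P.bondCurrent N ⟨b, h⟩ y ∂(P.transitionKernel N T T s.toNNReal z)) ∂(P.gibbsMeasure N T) else 0;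
       let V : ℕ → ℕ → ℝ → ℝ := fun N b t => 2 * ∫ s in (0 : ℝ)..t, (t - s) * C N b s;
       ∃ B : ℝ, ∀ N : ℕ, 2 ≤ N → ∀ t : ℝ, 1 ≤ t → V N 0 t ≤ B * t) := by
  intro ω₂ lam β γ hω hl hβ hγ T hT P C V
  obtain ⟨σ2, hσ⟩ := pinnedChain_bathBondHeatVar_le_linear_allTimes hω hl hβ hγ hT
  refine ⟨4 * γ * T ^ 2 + 8 * max σ2 0, fun N hN t ht1 => ?_⟩
  have hN1 : 1 < N := by omega
  have hN0 : 0 < N := by omega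
  have ht0 : 0 ≤ t := by linarith
  have key := hσ N hN1 t ht0
  have h8 : 8 * σ2 ≤ 8 * max σ2 0 * t := by
    calc 8 * σ2 ≤ 8 * max σ2 0 := by linarith [le_max_left σ2 0]
      _ = 8 * max σ2 0 * 1 := (mul_one _).symm
      _ ≤ 8 * max σ2 0 * t := mul_le_mul_of_nonneg_left ht1 (by positivity)
  simp only [V, C, dif_pos hN0]
  calc _ ≤ 4 * γ * T ^ 2 * t + 8 * σ2 := key
    _ ≤ 4 * γ * T ^ 2 * t + 8 * max σ2 0 * t := by linarith
    _ = (4 * γ * T ^ 2 + 8 * max σ2 0) * t := by ring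

end Summit.AtomisticToContinuum.FouriersLaw.Theorems.SubdiffusiveBondHeat

end
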